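import Summits.HodgeConjecture.HodgeConjecture.Theorems.Ring2AbelianAllAndreWeightGysinSupport
import Summits.HodgeConjecture.HodgeConjecture.Theorems.Ring2AbelianAllAndreSpreadVerdier
import HarnessLib

/-!
# Ring 2 · sub-cell AbelianAll (ALL ABELIAN VARIETIES), André axis, part XXV-f — THE BASE-CHANGE CLAUSE (gysFib) ON GYSIN IMAGES OF INVARIANT
# CLASSES IS FACT-FREE; what remains of the Leray weights is `ν`-free

HONEST FRAMING (page 1, verbatim): **research route, not a corollary; conditional on HC_CM plus one named
minimal statement.** Cell line: research route conditional on HC_CM; not a corollary; Q11.4-sentence-2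
already refuted in dim ≥ 3. Nothing in this file proves a case of the Hodge conjecture for an abelian variety; `HC_CM`
(`RankFourFaces.CMAbelianHodge`) is a HYPOTHESIS of the `HC_AV` row, load-bearing as typed; item `Theses.RankFourFaces.CMToAbelian`
(stmt-16267) OPEN and not closed here. Seat `pub-hodge-ring2-ab-andre-2`, gen 17; brief (iii) "attack `B_min`: what is known".

## What this file proves

Part XXV-e left displayed, inside `CMThetaGysinFib[]`, the base-change clause (gysFib): `ν^*(j_{s*} x) = Nᵃ · j_{s*} x` for every `x ∈ Hᵃ(X_s)`.
**`map_complexGysin_map_fiberι_eq_smul`**: (gysFib) HOLDS, with NO hypothesis beyond "`ν` is an `S`-endomorphism charted by `[N]` at `s`",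
on the Gysin images of INVARIANT classes `x = j_s^* y`: by the projection formula `j_{s*}(j_s^* y) = y ∪ [X_s]` (`complexGysin_cup`), the
divisor line `[X_s] = c · f^*η` (`exists_complexGysin_fiberι_one_eq_smul_map`) and `ν ≫ f = f` one has `ν^*[X_s] = [X_s]`, so
`ν^* j_{s*} j_s^* y = ν^* y ∪ [X_s] = j_{s*} j_s^*(ν^* y) = Nᵃ · j_{s*} j_s^* y` (part XXV-a's `fibreWeight_of_chart`). Hence
(**`gysinWeight_of_range_le`**) (gysFib) follows from (θ at `s`) and the `ν`-FREE clause
**(surjInv) `j_{s*}(Hᵃ(X_s)) ⊆ j_{s*}(j_s^* Hᵃ(𝒳))`** — "every Gysin image from a fibre is the Gysin image of an invariant class" (print: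
`j_{s*}` kills the variant part `(T−1)Hᵃ(X_s)` of the monodromy representation and `Hᵃ(X_s) = Hᵃ(X_s)^π ⊕ (variant)` by Deligne's
semisimplicity; equivalently `rank j_{s*} = dim Hᵃ(X_s)^π`, Poincaré duality + hard Lefschetz on the invariants). Node level (display-only):
bracket **`CMThetaInv[]`** := ∃ `ν` lqf, `N ≥ 2`, `ν ≫ f = f`, (θ∀), and (surjInv) at every point; **`cmThetaGysinFib_of_cmThetaInv`**,
**`cmWeights_of_cmThetaInv`**, row `HC_AV_of_HC_CM_of_cmTopWeightHodge_of_thetaInv`.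

## Honest status

No node is born; nothing is minimal; nothing here is fact-free progress on `HC_AV`. After parts XXV-a…f the displayed weight hypothesis of the
André-axis rows consists of (θ∀) — the abelian-scheme structure of a compact pencil (a locally quasi-finite `S`-endomorphism charted by `[N]`
on every fibre; Mumford GIT 6.14) — and ONE `ν`-free statement about compact abelian pencils, (surjInv). Everything the gen-16 bracket
`CMWeights[]` said about the Leray spectral sequence of `θ_N` is now a kernel consequence of these two.

References: FultonYoungTableaux1997 (App. B (6)); Fulton1998 (§19.1 Ex. 19.1.11); DeligneHodgeII1971 (Thm. 4.1.1, Cor. 4.2.8);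
VoisinHodgeII2003 (§4.3.3 Thm. 4.24); Milne2020HodgeClassesAV (proof of Prop. 1); MumfordGIT (Thm. 6.14).
-/

noncomputable section

set_option linter.dupNamespace false

namespace Summit.HodgeConjecture.HodgeConjecture.Ring2.AbelianAll

open CategoryTheory CategoryTheory.Limits AlgebraicGeometry
open Literature.AlgebraicGeometry Literature.AlgebraicGeometry.Motives
open Literature.AlgebraicGeometry.HodgeTheory
open Literature.AlgebraicGeometry.Deligne1982 (cmLocus)
open Literature.AlgebraicGeometry.Andre1996 (andre1996_cmAnchoredPencil)
open Literature.AlgebraicTopology.SingularHomology (singularCohomology cupProduct cupProduct_map cupProduct_one)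
open Summit.HodgeConjecture.HodgeConjecture
open Summit.HodgeConjecture.HodgeConjecture.Theses

/-! ## §1 (gysFib) on Gysin images of invariant classes is fact-free -/

section Invariant

variable {𝒳 S : SchemeOver ℂ} {d : ℕ} {f : 𝒳 ⟶ S}

/-- **`ν^*[X_s] = [X_s]` for an `S`-endomorphism**: the fibre class is a multiple of `f^* η` (divisor line), and `(ν ≫ f)^* = f^*`.
[cite: Fulton1998, §19.1 Example 19.1.11] [cite: FultonYoungTableaux1997, Appendix B §B.1 (6)] -/
theorem map_complexGysin_fiberι_one (hf : IsCompactAbelianPencil f d) (s : ComplexPoints S) (ν : 𝒳 ⟶ 𝒳) (hν : ν ≫ f = f) :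
    complexBetti.map ν 2 (complexGysin complexOrientationFamily (hf.isSmoothProjective_fiberOver s) hf.isSmoothProjective_total
      (fiberι f s) (show 0 + 2 * (d + 1) = 2 + 2 * d by ring) (singularCohomology.one ℂ (ComplexPoints (fiberOver f s)))) =
      complexGysin complexOrientationFamily (hf.isSmoothProjective_fiberOver s) hf.isSmoothProjective_total
        (fiberι f s) (show 0 + 2 * (d + 1) = 2 + 2 * d by ring) (singularCohomology.one ℂ (ComplexPoints (fiberOver f s))) := by
  haveI : Surjective f.left := surjective_left_of_isSmoothProjectiveFamily hf.isSmoothProjective_base hf.isSmoothProjectiveFamily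
  obtain ⟨η, hη⟩ := exists_ne_zero_complexBetti_two_of_curve hf.isSmoothProjective_base
  obtain ⟨c, hc⟩ := exists_complexGysin_fiberι_one_eq_smul_map complexOrientationFamily hf.isSmoothProjective_total
    hf.isSmoothProjective_base f s (hf.isSmoothProjective_fiberOver s) hη
  rw [hc, map_smul, ← CategoryTheory.comp_apply, ← complexBetti.map_comp, hν]

/-- **(gysFib) ON GYSIN IMAGES OF INVARIANT CLASSES, FACT-FREE.** For a compact pencil of abelian `d`-folds, an `S`-endomorphism `ν` charted by
`N · 𝟙_A` on the fibre `X_s`, and every `y ∈ Hᵃ(𝒳)`: `ν^*(j_{s*}(j_s^* y)) = Nᵃ · j_{s*}(j_s^* y)` — projection formula `j_{s*} j_s^* y = y ∪ [X_s]`,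
`ν^*[X_s] = [X_s]`, and `j_s^* ν^* = Nᵃ j_s^*` (part XXV-a). [cite: FultonYoungTableaux1997, Appendix B §B.1 (5)–(6)]
[cite: Milne2020HodgeClassesAV, proof of Prop. 1 (p. 7)] [cite: MumfordAV1970, §19] -/
theorem map_complexGysin_map_fiberι_eq_smul (hf : IsCompactAbelianPencil f d) (s : ComplexPoints S) (ν : 𝒳 ⟶ 𝒳) (hν : ν ≫ f = f)
    (N : ℕ) (hθ : ∃ (νs : fiberOver f s ⟶ fiberOver f s) (A : AbelianVariety ℂ) (e : A.X ≅ fiberOver f s),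
      νs ≫ fiberι f s = fiberι f s ≫ ν ∧ e.hom ≫ νs = (N • 𝟙 A).hom.hom.hom ≫ e.hom)
    {a b : ℕ} (hab : a + 2 * (d + 1) = b + 2 * d) (y : complexBetti 𝒳 a) :
    complexBetti.map ν b (complexGysin complexOrientationFamily (hf.isSmoothProjective_fiberOver s) hf.isSmoothProjective_total
      (fiberι f s) hab (complexBetti.map (fiberι f s) a y)) =
      ((N : ℂ) ^ a) • complexGysin complexOrientationFamily (hf.isSmoothProjective_fiberOver s) hf.isSmoothProjective_total
        (fiberι f s) hab (complexBetti.map (fiberι f s) a y) := by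
  obtain ⟨νs, A, e, hνs, he⟩ := hθ
  have hb : a + 2 = b := by omega
  -- projection formula `j_*(j^* y ∪ 1) = y ∪ j_* 1`
  have hproj : ∀ y' : complexBetti 𝒳 a,
      complexGysin complexOrientationFamily (hf.isSmoothProjective_fiberOver s) hf.isSmoothProjective_total (fiberι f s) hab
        (complexBetti.map (fiberι f s) a y') =
      cupProduct hb y' (complexGysin complexOrientationFamily (hf.isSmoothProjective_fiberOver s) hf.isSmoothProjective_total
        (fiberι f s) (show 0 + 2 * (d + 1) = 2 + 2 * d by ring) (singularCohomology.one ℂ (ComplexPoints (fiberOver f s)))) := by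
    intro y'
    have h := complexGysin_cup (μ := complexOrientationFamily) hasPoincareDuality_complexOrientationFamily
      (hf.isSmoothProjective_fiberOver s) hf.isSmoothProjective_total (fiberι f s) (Nat.add_zero a) hab
      (show 0 + 2 * (d + 1) = 2 + 2 * d by ring) hb y' (singularCohomology.one ℂ (ComplexPoints (fiberOver f s)))
    rw [cupProduct_one] at h
    exact h
  rw [hproj, cupProduct_map, map_complexGysin_fiberι_one hf s ν hν, ← hproj, fibreWeight_of_chart s ν νs hνs A e N he a y, map_smul,
    hproj]

/-- **(gysFib) from (θ at `s`) and the `ν`-FREE clause (surjInv) "every Gysin image from `X_s` is the Gysin image of an invariant class".**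
[cite: DeligneHodgeII1971, Thm. 4.1.1 and Cor. 4.2.8] [cite: VoisinHodgeII2003, §4.3.3 Thm. 4.24] -/
theorem gysinWeight_of_range_le (hf : IsCompactAbelianPencil f d) (s : ComplexPoints S) (ν : 𝒳 ⟶ 𝒳) (hν : ν ≫ f = f) (N : ℕ)
    (hθ : ∃ (νs : fiberOver f s ⟶ fiberOver f s) (A : AbelianVariety ℂ) (e : A.X ≅ fiberOver f s),
      νs ≫ fiberι f s = fiberι f s ≫ ν ∧ e.hom ≫ νs = (N • 𝟙 A).hom.hom.hom ≫ e.hom)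
    (hsurj : ∀ (a b : ℕ) (hab : a + 2 * (d + 1) = b + 2 * d) (x : complexBetti (fiberOver f s) a), ∃ y : complexBetti 𝒳 a,
      complexGysin complexOrientationFamily (hf.isSmoothProjective_fiberOver s) hf.isSmoothProjective_total (fiberι f s) hab x =
        complexGysin complexOrientationFamily (hf.isSmoothProjective_fiberOver s) hf.isSmoothProjective_total (fiberι f s) hab
          (complexBetti.map (fiberι f s) a y))
    (a b : ℕ) (hab : a + 2 * (d + 1) = b + 2 * d) (x : complexBetti (fiberOver f s) a) :
    complexBetti.map ν b (complexGysin complexOrientationFamily (hf.isSmoothProjective_fiberOver s) hf.isSmoothProjective_total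
      (fiberι f s) hab x) =
      ((N : ℂ) ^ a) • complexGysin complexOrientationFamily (hf.isSmoothProjective_fiberOver s) hf.isSmoothProjective_total
        (fiberι f s) hab x := by
  obtain ⟨y, hy⟩ := hsurj a b hab x
  rw [hy]
  exact map_complexGysin_map_fiberι_eq_smul hf s ν hν N hθ hab y

end Invariant

/-! ## §2 Node level (display-only brackets): `CMThetaInv[] ⟹ CMThetaGysinFib[] ⟹ CMWeights[]` and the row -/

section Nodes

/-- DISPLAY-ONLY bracket (no `def`; REFEREE-AB F-ab-103): `CMWeights[]` of part XXIV-c, restated verbatim. -/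
local notation3 (prettyPrint := false) "CMWeights[]" =>
  ∀ ⦃d : ℕ⦄ ⦃𝒳 S : SchemeOver ℂ⦄ (f : 𝒳 ⟶ S), IsCompactAbelianPencil f d → ∀ t ∈ cmLocus f d,
    ∃ (ν : 𝒳 ⟶ 𝒳) (_ : LocallyQuasiFinite ν.left) (N : ℕ), 2 ≤ N ∧
      (∀ (k : ℕ) (w : complexBetti 𝒳 k), complexBetti.map (fiberι f t) k (complexBetti.map ν k w) =
        ((N : ℂ) ^ k) • complexBetti.map (fiberι f t) k w) ∧
      (∀ (k k₁ k₂ : ℕ), k₁ + 1 = k → k₂ + 1 = k₁ → ∀ w : complexBetti 𝒳 k, ∃ w₀ w₁ w₂ : complexBetti 𝒳 k,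
        w = w₀ + w₁ + w₂ ∧ complexBetti.map ν k w₀ = ((N : ℂ) ^ k) • w₀ ∧ complexBetti.map ν k w₁ = ((N : ℂ) ^ k₁) • w₁ ∧
        complexBetti.map ν k w₂ = ((N : ℂ) ^ k₂) • w₂) ∧
      (∀ (k : ℕ) (G : complexBetti 𝒳 k), complexBetti.map ν k G = ((N : ℂ) ^ k) • G →
        complexBetti.map (fiberι f t) k G = 0 → G = 0)

/-- DISPLAY-ONLY bracket (no `def`; REFEREE-AB F-ab-103): `CMThetaGysinFib[]` of part XXV-e, restated verbatim. -/
local notation3 (prettyPrint := false) "CMThetaGysinFib[]" =>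
  ∀ ⦃d : ℕ⦄ ⦃𝒳 S : SchemeOver ℂ⦄ (f : 𝒳 ⟶ S) (hf : IsCompactAbelianPencil f d), ∀ t ∈ cmLocus f d,
    ∃ (ν : 𝒳 ⟶ 𝒳) (_ : LocallyQuasiFinite ν.left) (N : ℕ), 2 ≤ N ∧ ν ≫ f = f ∧
      (∀ s : ComplexPoints S, ∃ (νs : fiberOver f s ⟶ fiberOver f s) (A : AbelianVariety ℂ) (e : A.X ≅ fiberOver f s),
        νs ≫ fiberι f s = fiberι f s ≫ ν ∧ e.hom ≫ νs = (N • 𝟙 A).hom.hom.hom ≫ e.hom) ∧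
      (∀ (s : ComplexPoints S) (a b : ℕ) (hab : a + 2 * (d + 1) = b + 2 * d) (x : complexBetti (fiberOver f s) a),
        complexBetti.map ν b (complexGysin complexOrientationFamily (hf.isSmoothProjective_fiberOver s) hf.isSmoothProjective_total
          (fiberι f s) hab x) =
          ((N : ℂ) ^ a) • complexGysin complexOrientationFamily (hf.isSmoothProjective_fiberOver s) hf.isSmoothProjective_total
            (fiberι f s) hab x)

/-- DISPLAY-ONLY bracket (no `def`; REFEREE-AB F-ab-103): `CMTopWeightHodge[]` of part XXIV-d, restated verbatim. OPEN; a HYPOTHESIS. -/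
local notation3 (prettyPrint := false) "CMTopWeightHodge[]" =>
  ∀ ⦃d : ℕ⦄ ⦃𝒳 S : SchemeOver ℂ⦄ (f : 𝒳 ⟶ S), IsCompactAbelianPencil f d → ∀ t ∈ cmLocus f d,
    ∀ (ν : 𝒳 ⟶ 𝒳) (_ : LocallyQuasiFinite ν.left) (N : ℕ), 2 ≤ N →
      (∀ (k : ℕ) (w : complexBetti 𝒳 k), complexBetti.map (fiberι f t) k (complexBetti.map ν k w) =
        ((N : ℂ) ^ k) • complexBetti.map (fiberι f t) k w) →
      (∀ (k k₁ k₂ : ℕ), k₁ + 1 = k → k₂ + 1 = k₁ → ∀ w : complexBetti 𝒳 k, ∃ w₀ w₁ w₂ : complexBetti 𝒳 k,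
        w = w₀ + w₁ + w₂ ∧ complexBetti.map ν k w₀ = ((N : ℂ) ^ k) • w₀ ∧ complexBetti.map ν k w₁ = ((N : ℂ) ^ k₁) • w₁ ∧
        complexBetti.map ν k w₂ = ((N : ℂ) ^ k₂) • w₂) →
      (∀ (k : ℕ) (G : complexBetti 𝒳 k), complexBetti.map ν k G = ((N : ℂ) ^ k) • G →
        complexBetti.map (fiberι f t) k G = 0 → G = 0) →
      ∀ (p : ℕ) (y₀ : complexBetti 𝒳 (2 * (p + 1))),
        complexBetti.map ν (2 * (p + 1)) y₀ = ((N : ℂ) ^ (2 * (p + 1))) • y₀ → IsRationalClass y₀ →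
        IsOfHodgeType (d + 1) 𝒳 (2 * (p + 1)) (p + 1) (p + 1) y₀ → y₀ ∈ algebraicClasses 𝒳 (p + 1)

/-- DISPLAY-ONLY bracket (no `def`, not a census node — REFEREE-AB F-ab-103): **`CMThetaInv[]`** — at every CM point of every compact abelian pencil
there are a locally quasi-finite `S`-ENDOMORPHISM `ν` and `N ≥ 2` with (θ∀) charts by `N · 𝟙_A` on every fibre (print: `θ_N`, Mumford GIT 6.14),
AND the `ν`-FREE clause (surjInv): at every point `s`, every Gysin image `j_{s*} x` is the Gysin image `j_{s*}(j_s^* y)` of an INVARIANT class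
(print: Deligne's semisimplicity of the monodromy representation — `j_{s*}` kills the variant part). PRINT THEOREMS, displayed. -/
local notation3 (prettyPrint := false) "CMThetaInv[]" =>
  ∀ ⦃d : ℕ⦄ ⦃𝒳 S : SchemeOver ℂ⦄ (f : 𝒳 ⟶ S) (hf : IsCompactAbelianPencil f d), ∀ t ∈ cmLocus f d,
    ∃ (ν : 𝒳 ⟶ 𝒳) (_ : LocallyQuasiFinite ν.left) (N : ℕ), 2 ≤ N ∧ ν ≫ f = f ∧
      (∀ s : ComplexPoints S, ∃ (νs : fiberOver f s ⟶ fiberOver f s) (A : AbelianVariety ℂ) (e : A.X ≅ fiberOver f s),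
        νs ≫ fiberι f s = fiberι f s ≫ ν ∧ e.hom ≫ νs = (N • 𝟙 A).hom.hom.hom ≫ e.hom) ∧
      (∀ (s : ComplexPoints S) (a b : ℕ) (hab : a + 2 * (d + 1) = b + 2 * d) (x : complexBetti (fiberOver f s) a),
        ∃ y : complexBetti 𝒳 a,
          complexGysin complexOrientationFamily (hf.isSmoothProjective_fiberOver s) hf.isSmoothProjective_total (fiberι f s) hab x =
            complexGysin complexOrientationFamily (hf.isSmoothProjective_fiberOver s) hf.isSmoothProjective_total (fiberι f s) hab
              (complexBetti.map (fiberι f s) a y))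

/-- **`CMThetaInv[] ⟹ CMThetaGysinFib[]`** (§1 at every point). [cite: FultonYoungTableaux1997, Appendix B §B.1 (5)–(6)] [cite: DeligneHodgeII1971, Cor. 4.2.8] -/
theorem cmThetaGysinFib_of_cmThetaInv (hΘ : CMThetaInv[]) : CMThetaGysinFib[] := by
  intro d 𝒳 S f hf t ht
  obtain ⟨ν, hν, N, hN, hνf, hθ, hsurj⟩ := hΘ f hf t ht
  exact ⟨ν, hν, N, hN, hνf, hθ, fun s a b hab x ↦ gysinWeight_of_range_le hf s ν hνf N (hθ s) (hsurj s) a b hab x⟩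

/-- **`CMThetaInv[] ⟹ CMWeights[]`**: the whole Leray weight package of part XXIV from the abelian-scheme structure (θ∀) and the `ν`-free clause
(surjInv) (parts XXV-a, d, e, f). [cite: Milne2020HodgeClassesAV, proof of Prop. 1 (p. 7)] [cite: MumfordGIT, Thm. 6.14]
[cite: DeligneHodgeII1971, Thm. 4.1.1 and Cor. 4.2.8] -/
theorem cmWeights_of_cmThetaInv (hΘ : CMThetaInv[]) : CMWeights[] :=
  cmWeights_of_cmThetaGysinFib (cmThetaGysinFib_of_cmThetaInv hΘ)

/-- **`HC_CM ∧ [CM top-weight Hodge classes algebraic] ⟹ HC_AV`, granted [h₂₁] and `CMThetaInv[]`** (binders in this order; `HC_CM` =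
`RankFourFaces.CMAbelianHodge` a HYPOTHESIS, load-bearing). research route, not a corollary; conditional on HC_CM plus one named minimal statement.
[cite: Andre1996Motifs, Lemme 6.3.1 (p. 31) and Remarque 2 (p. 33)] [cite: Milne2020HodgeClassesAV, proof of Prop. 1 (pp. 7–8)] -/
theorem HC_AV_of_HC_CM_of_cmTopWeightHodge_of_thetaInv (h₂₁ : andre1996_cmAnchoredPencil) (hΘ : CMThetaInv[])
    (hCM : RankFourFaces.CMAbelianHodge) (h : CMTopWeightHodge[]) : PadicSemiregularLift.HodgeAbelianVarieties :=
  HC_AV_of_HC_CM_of_cmTopWeightHodge_of_thetaGysinFib h₂₁ (cmThetaGysinFib_of_cmThetaInv hΘ) hCM h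

/-- **EXACTNESS: `HC_AV ⟺ HC_CM ∧ [CM top-weight Hodge classes algebraic]`, granted [h₂₁], Verdier and `CMThetaInv[]`.**
[cite: Andre1996Motifs, Lemme 6.3.1 (p. 31) and Remarque 2 (p. 33)] [cite: Verdier1976, Cor. 5.1] -/
theorem HC_AV_iff_HC_CM_and_cmTopWeightHodge_of_verdier_of_thetaInv (h₂₁ : andre1996_cmAnchoredPencil)
    (hGT : Verdier1976_genericLocalTriviality) (hΘ : CMThetaInv[]) :
    PadicSemiregularLift.HodgeAbelianVarieties ↔ (RankFourFaces.CMAbelianHodge ∧ CMTopWeightHodge[]) :=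
  HC_AV_iff_HC_CM_and_cmTopWeightHodge_of_verdier_of_thetaGysinFib h₂₁ hGT (cmThetaGysinFib_of_cmThetaInv hΘ)

end Nodes

end Summit.HodgeConjecture.HodgeConjecture.Ring2.AbelianAll

end
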